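import Literature.NumberTheory.LFunctions.YoshidaWindowGramMiddleJ
import Literature.NumberTheory.LFunctions.YoshidaWindowGramColumnData
import HarnessLib

/-!
# Kernel enclosures of Yoshida's matrix coefficients — XI-b: BOXES of the compressed exact middle (factored form)

Source: H. Yoshida, Adv. Stud. Pure Math. **21** (1992) 281–325, §§6–7 [Yoshida1992HermitianForms]; R. E. Moore,
*Interval Analysis* (1966), Ch. 3 [Moore1966] (inclusion property).

Part XI-a gives the middle matrices `UmidEvenJ`/`UmidOddJ` in factored form with right factors `psiMidE(S)`/`psiMidO(S)`
and diagonals `dMidE`/`dMidO`, all built from the `(2J)×(2J)` middle Gram blocks `hmAA/hmAB/hmBA/hmBB` and the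
moment `smid` — FINITE sums over the middle columns `[B₃, B₃ + K)` of products of the exact column profiles.  Here, for
the reciprocal dyadic column weights `w = wvF v cv B₃` of part IX (`1/w(B₃+t) = v_t/2^{cv}`):

* boxes of the profiles from the LIGHT column records (`fAeBox`, `fAoBox`; the `B`-profiles are exact rationals) and of
  every block entry / the moment as `sumBox`es over the light table (`hmAAeBox`, …, `smidEBox`; odd alike), with `mem`
  lemmas under `TabColValid` on the middle range;
* the MOMENT RECORD `MidMom` (the four blocks as `J×J` lists + the moment), its computation `midMomE`/`midMomO` and
  validity `MidMomValidE`/`MidMomValidO` (`midMomE_valid`, `midMomO_valid`) — evaluated ONCE and passed to the factor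
  boxes, so a kernel certificate pays the middle sums once per declaration;
* boxes `psiMidEBox`, `psiMidESBox` (`= ψ·B^{p(r)}`), `dMidEBox` (+ odd) from a moment record and the FULL record of
  the block mode, with `mem` lemmas.

Everything is proved; no named facts.
-/

open Real Complex Finset Matrix
open scoped BigOperators

namespace Literature.NumberTheory.LFunctions.Yoshida1992

open Literature.Analysis.SpecialFunctions Literature.Analysis.ValidatedNumerics.NumericsMP
open Literature.Analysis.ValidatedNumerics

namespace Encl

variable {S : ℕ} {a : ℝ} {ks : List PrimeLen} {C : Consts}

/-! ## Column profiles -/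

/-- Box of the even `A`-profile `F_m/(π m^{2j+1})` from the record of the column mode `m`.
[cite: Moore1966, Ch. 3 (interval arithmetic: inclusion property)] -/
def fAeBox (S : ℕ) (C : Consts) (R : IdxRec) (m j : ℕ) : MI := ((modeFBox S C R).mul S C.invPi).divNat (m ^ (2 * j + 1))

/-- [cite: Moore1966, Ch. 3 (interval arithmetic: inclusion property)] -/
theorem mem_fAeBox (hS : 0 < S) (hks : PrimeData a ks) (hC : ConstsValid S a ks C) {m : ℕ} (hm : 0 < m) (j : ℕ)
    {R : IdxRec} (hR : OffValid S a ks (m : ℤ) R) :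
    MI.mem S (modeF a m / π / (m : ℝ) ^ (2 * j + 1)) (fAeBox S C R m j) := by
  unfold fAeBox
  have h := MI.mem_divNat (MI.mem_mul hS (mem_modeFBox hS hks hC hR) hC.invPi) (n := m ^ (2 * j + 1)) (Nat.pow_pos hm)
  refine mem_of_eq h ?_
  push_cast; ring

/-- Box of the odd `A`-profile `F_{l+1}/(π (l+1)^{2j+2})` from the record of the column mode `l + 1`.
[cite: Moore1966, Ch. 3 (interval arithmetic: inclusion property)] -/
def fAoBox (S : ℕ) (C : Consts) (R : IdxRec) (l j : ℕ) : MI :=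
  ((modeFBox S C R).mul S C.invPi).divNat ((l + 1) ^ (2 * j + 2))

/-- [cite: Moore1966, Ch. 3 (interval arithmetic: inclusion property)] -/
theorem mem_fAoBox (hS : 0 < S) (hks : PrimeData a ks) (hC : ConstsValid S a ks C) (l j : ℕ)
    {R : IdxRec} (hR : OffValid S a ks ((l : ℤ) + 1) R) :
    MI.mem S (modeF a ((l : ℤ) + 1) / π / ((l : ℝ) + 1) ^ (2 * j + 2)) (fAoBox S C R l j) := by
  unfold fAoBox
  have h := MI.mem_divNat (MI.mem_mul hS (mem_modeFBox hS hks hC hR) hC.invPi) (n := (l + 1) ^ (2 * j + 2)) (Nat.pow_pos (Nat.succ_pos l))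
  refine mem_of_eq h ?_
  push_cast; ring

/-- `Σ_{m∈[B₃,B₃+K)} g m / w m = Σ_{t<K} g(B₃+t) · v_t/2^{cv}` for the reciprocal dyadic weights.
[cite: Moore1966, Ch. 3 (interval arithmetic: inclusion property)] -/
theorem sum_Ico_div_wvF (g : ℕ → ℝ) (v : List ℕ) (cv B₃ K : ℕ) :
    ∑ m ∈ Finset.Ico B₃ (B₃ + K), g m / wvF v cv B₃ m = ∑ t ∈ Finset.range K, g (B₃ + t) * (v.getD t 0 : ℝ) / 2 ^ cv := by
  rw [Finset.sum_Ico_eq_sum_range, Nat.add_sub_cancel_left]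
  refine Finset.sum_congr rfl fun t _ ↦ ?_
  rw [div_eq_mul_one_div, one_div_wvF]; ring

/-- Generic: box of `Σ_{m∈[B₃,B₃+K)} g m / w m` from termwise boxes `G t ∋ g(B₃+t)`.
[cite: Moore1966, Ch. 3 (interval arithmetic: inclusion property)] -/
theorem mem_sumBox_div_wvF (S : ℕ) {g : ℕ → ℝ} {G : ℕ → MI} (v : List ℕ) (cv B₃ K : ℕ)
    (hG : ∀ t < K, MI.mem S (g (B₃ + t)) (G t)) :
    MI.mem S (∑ m ∈ Finset.Ico B₃ (B₃ + K), g m / wvF v cv B₃ m)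
      (sumBox S (fun t ↦ ((G t).mulInt (v.getD t 0 : ℤ)).divNat (2 ^ cv)) K) := by
  rw [sum_Ico_div_wvF]
  refine mem_sumBox S K fun t ht ↦ ?_
  have h := MI.mem_divNat (MI.mem_mulInt (hG t ht) (v.getD t 0 : ℤ)) (n := 2 ^ cv) (by positivity)
  refine mem_of_eq h ?_
  push_cast; ring

/-! ## Even sector: block boxes, the moment record, factor boxes -/

/-- Box of `hmAAe` over the light table. [cite: Moore1966, Ch. 3 (interval arithmetic: inclusion property)] -/
def hmAAeBox (S : ℕ) (C : Consts) (ctab : List IdxRec) (cv : ℕ) (v : List ℕ) (B₃ K j j' : ℕ) : MI :=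
  sumBox S (fun t ↦ (((fAeBox S C (tget ctab (B₃ + t)) (B₃ + t) j).mul S (fAeBox S C (tget ctab (B₃ + t)) (B₃ + t) j')).mulInt
    (v.getD t 0 : ℤ)).divNat (2 ^ cv)) K

/-- Box of `hmABe`. [cite: Moore1966, Ch. 3 (interval arithmetic: inclusion property)] -/
def hmABeBox (S : ℕ) (C : Consts) (ctab : List IdxRec) (cv : ℕ) (v : List ℕ) (B₃ K j r' : ℕ) : MI :=
  sumBox S (fun t ↦ (((fAeBox S C (tget ctab (B₃ + t)) (B₃ + t) j).mul S (MI.ofFrac S 1 ((B₃ + t) ^ (2 * r' + 2)))).mulInt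
    (v.getD t 0 : ℤ)).divNat (2 ^ cv)) K

/-- Box of `hmBAe`. [cite: Moore1966, Ch. 3 (interval arithmetic: inclusion property)] -/
def hmBAeBox (S : ℕ) (C : Consts) (ctab : List IdxRec) (cv : ℕ) (v : List ℕ) (B₃ K r' j : ℕ) : MI :=
  sumBox S (fun t ↦ (((MI.ofFrac S 1 ((B₃ + t) ^ (2 * r' + 2))).mul S (fAeBox S C (tget ctab (B₃ + t)) (B₃ + t) j)).mulInt
    (v.getD t 0 : ℤ)).divNat (2 ^ cv)) K

/-- Box of `hmBBe` (exact rationals). [cite: Moore1966, Ch. 3 (interval arithmetic: inclusion property)] -/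
def hmBBeBox (S : ℕ) (cv : ℕ) (v : List ℕ) (B₃ K r' r'' : ℕ) : MI :=
  sumBox S (fun t ↦ (((MI.ofFrac S 1 ((B₃ + t) ^ (2 * r' + 2))).mul S (MI.ofFrac S 1 ((B₃ + t) ^ (2 * r'' + 2)))).mulInt
    (v.getD t 0 : ℤ)).divNat (2 ^ cv)) K

/-- Box of `smidE`. [cite: Moore1966, Ch. 3 (interval arithmetic: inclusion property)] -/
def smidEBox (S : ℕ) (cv : ℕ) (v : List ℕ) (B₃ K J : ℕ) : MI :=
  sumBox S (fun t ↦ (((MI.ofFrac S 1 ((B₃ + t) ^ (2 * J + 1))).sqr S).mulInt (v.getD t 0 : ℤ)).divNat (2 ^ cv)) K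

variable {ctab : List IdxRec} {cv B₃ K : ℕ} {v : List ℕ}

/-- [cite: Moore1966, Ch. 3 (interval arithmetic: inclusion property)] -/
theorem mem_hmAAeBox (hS : 0 < S) (hks : PrimeData a ks) (hC : ConstsValid S a ks C)
    (hCT : TabColValid S a ks B₃ (B₃ + K) ctab) (hB₃ : 0 < B₃) (j j' : ℕ) :
    MI.mem S (hmAAe a (wvF v cv B₃) B₃ (B₃ + K) j j') (hmAAeBox S C ctab cv v B₃ K j j') := by
  unfold hmAAe hmAAeBox
  refine mem_sumBox_div_wvF S v cv B₃ K fun t ht ↦ ?_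
  have hR := (hCT (B₃ + t) (by omega) (by omega)).1
  have hm : 0 < B₃ + t := by omega
  have h := MI.mem_mul hS (mem_fAeBox hS hks hC hm j hR) (mem_fAeBox hS hks hC hm j' hR)
  exact mem_of_eq h (by push_cast; ring)

/-- [cite: Moore1966, Ch. 3 (interval arithmetic: inclusion property)] -/
theorem mem_hmABeBox (hS : 0 < S) (hks : PrimeData a ks) (hC : ConstsValid S a ks C)
    (hCT : TabColValid S a ks B₃ (B₃ + K) ctab) (hB₃ : 0 < B₃) (j r' : ℕ) :
    MI.mem S (hmABe a (wvF v cv B₃) B₃ (B₃ + K) j r') (hmABeBox S C ctab cv v B₃ K j r') := by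
  unfold hmABe hmABeBox
  refine mem_sumBox_div_wvF S v cv B₃ K fun t ht ↦ ?_
  have hR := (hCT (B₃ + t) (by omega) (by omega)).1
  have hm : 0 < B₃ + t := by omega
  have h := MI.mem_mul hS (mem_fAeBox hS hks hC hm j hR) (MI.mem_ofFrac S 1 (q := (B₃ + t) ^ (2 * r' + 2)) (Nat.pow_pos hm))
  exact mem_of_eq h (by push_cast; ring)

/-- [cite: Moore1966, Ch. 3 (interval arithmetic: inclusion property)] -/
theorem mem_hmBAeBox (hS : 0 < S) (hks : PrimeData a ks) (hC : ConstsValid S a ks C)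
    (hCT : TabColValid S a ks B₃ (B₃ + K) ctab) (hB₃ : 0 < B₃) (r' j : ℕ) :
    MI.mem S (hmBAe a (wvF v cv B₃) B₃ (B₃ + K) r' j) (hmBAeBox S C ctab cv v B₃ K r' j) := by
  unfold hmBAe hmBAeBox
  refine mem_sumBox_div_wvF S v cv B₃ K fun t ht ↦ ?_
  have hR := (hCT (B₃ + t) (by omega) (by omega)).1
  have hm : 0 < B₃ + t := by omega
  have h := MI.mem_mul hS (MI.mem_ofFrac S 1 (q := (B₃ + t) ^ (2 * r' + 2)) (Nat.pow_pos hm)) (mem_fAeBox hS hks hC hm j hR)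
  exact mem_of_eq h (by push_cast; ring)

/-- [cite: Moore1966, Ch. 3 (interval arithmetic: inclusion property)] -/
theorem mem_hmBBeBox (S : ℕ) (hS : 0 < S) (v : List ℕ) (cv : ℕ) {B₃ : ℕ} (hB₃ : 0 < B₃) (K r' r'' : ℕ) :
    MI.mem S (hmBBe (wvF v cv B₃) B₃ (B₃ + K) r' r'') (hmBBeBox S cv v B₃ K r' r'') := by
  unfold hmBBe hmBBeBox
  refine mem_sumBox_div_wvF S v cv B₃ K fun t _ ↦ ?_
  have hm : 0 < B₃ + t := by omega
  have h := MI.mem_mul hS (MI.mem_ofFrac S 1 (q := (B₃ + t) ^ (2 * r' + 2)) (Nat.pow_pos hm))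
    (MI.mem_ofFrac S 1 (q := (B₃ + t) ^ (2 * r'' + 2)) (Nat.pow_pos hm))
  exact mem_of_eq h (by push_cast; ring)

/-- [cite: Moore1966, Ch. 3 (interval arithmetic: inclusion property)] -/
theorem mem_smidEBox (S : ℕ) (hS : 0 < S) (v : List ℕ) (cv : ℕ) {B₃ : ℕ} (hB₃ : 0 < B₃) (K J : ℕ) :
    MI.mem S (smidE (wvF v cv B₃) B₃ (B₃ + K) J) (smidEBox S cv v B₃ K J) := by
  unfold smidE smidEBox
  refine mem_sumBox_div_wvF S v cv B₃ K fun t _ ↦ ?_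
  have hm : 0 < B₃ + t := by omega
  have h := MI.mem_sqr hS (MI.mem_ofFrac S 1 (q := (B₃ + t) ^ (2 * J + 1)) (Nat.pow_pos hm))
  exact mem_of_eq h (by push_cast; ring)

/-- The middle MOMENT RECORD: the four `J×J` Gram blocks (row-major lists) and the remainder moment.
[cite: Yoshida1992HermitianForms, §7 pp. 305–312] -/
structure MidMom where
  /-- block `AA` -/
  AA : List (List MI)
  /-- block `AB` -/
  AB : List (List MI)
  /-- block `BA` -/
  BA : List (List MI)
  /-- block `BB` -/
  BB : List (List MI)
  /-- remainder moment -/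
  sm : MI
  deriving Repr, Inhabited

/-- Entry `(x, y)` of a list matrix of boxes (default beyond the ends). [folklore] -/
def getMI (L : List (List MI)) (x y : ℕ) : MI := (L.getD x []).getD y default

/-- `J×J` table of `f`. [folklore] -/
def tabJ (J : ℕ) (f : ℕ → ℕ → MI) : List (List MI) := (List.range J).map fun x ↦ (List.range J).map fun y ↦ f x y

/-- Reading a `tabJ` (plumbing). [folklore] -/
private theorem getMI_tabJ {J : ℕ} (f : ℕ → ℕ → MI) {x y : ℕ} (hx : x < J) (hy : y < J) : getMI (tabJ J f) x y = f x y := by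
  unfold getMI tabJ
  have h1 : ((List.range J).map fun x ↦ (List.range J).map fun y ↦ f x y).getD x [] = (List.range J).map fun y ↦ f x y := by
    rw [List.getD_eq_getElem?_getD, List.getElem?_map, List.getElem?_range hx]; rfl
  rw [h1, List.getD_eq_getElem?_getD, List.getElem?_map, List.getElem?_range hy]; rfl

/-- The even moment record computed from the light table. [cite: Yoshida1992HermitianForms, §7 pp. 305–312] -/
def midMomE (S : ℕ) (C : Consts) (ctab : List IdxRec) (cv : ℕ) (v : List ℕ) (B₃ K J : ℕ) : MidMom :=
  ⟨tabJ J (hmAAeBox S C ctab cv v B₃ K), tabJ J (hmABeBox S C ctab cv v B₃ K), tabJ J (hmBAeBox S C ctab cv v B₃ K),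
    tabJ J (hmBBeBox S cv v B₃ K), smidEBox S cv v B₃ K J⟩

/-- Validity of an even moment record for the weights `w` on `[B₃, B₄)`. [cite: Moore1966, Ch. 3 (interval arithmetic: inclusion property)] -/
structure MidMomValidE (S : ℕ) (a : ℝ) (w : ℕ → ℝ) (B₃ B₄ J : ℕ) (M : MidMom) : Prop where
  /-- block `AA` -/
  AA : ∀ j < J, ∀ j' < J, MI.mem S (hmAAe a w B₃ B₄ j j') (getMI M.AA j j')
  /-- block `AB` -/
  AB : ∀ j < J, ∀ r' < J, MI.mem S (hmABe a w B₃ B₄ j r') (getMI M.AB j r')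
  /-- block `BA` -/
  BA : ∀ r' < J, ∀ j < J, MI.mem S (hmBAe a w B₃ B₄ r' j) (getMI M.BA r' j)
  /-- block `BB` -/
  BB : ∀ r' < J, ∀ r'' < J, MI.mem S (hmBBe w B₃ B₄ r' r'') (getMI M.BB r' r'')
  /-- moment -/
  sm : MI.mem S (smidE w B₃ B₄ J) M.sm

/-- **The computed even moment record is valid** (light table valid on the middle range).
[cite: Moore1966, Ch. 3 (interval arithmetic: inclusion property)] -/
theorem midMomE_valid (hS : 0 < S) (hks : PrimeData a ks) (hC : ConstsValid S a ks C)
    (hCT : TabColValid S a ks B₃ (B₃ + K) ctab) (hB₃ : 0 < B₃) (J : ℕ) :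
    MidMomValidE S a (wvF v cv B₃) B₃ (B₃ + K) J (midMomE S C ctab cv v B₃ K J) where
  AA j hj j' hj' := by rw [midMomE, getMI_tabJ _ hj hj']; exact mem_hmAAeBox hS hks hC hCT hB₃ j j'
  AB j hj r' hr' := by rw [midMomE, getMI_tabJ _ hj hr']; exact mem_hmABeBox hS hks hC hCT hB₃ j r'
  BA r' hr' j hj := by rw [midMomE, getMI_tabJ _ hr' hj]; exact mem_hmBAeBox hS hks hC hCT hB₃ r' j
  BB r' hr' r'' hr'' := by rw [midMomE, getMI_tabJ _ hr' hr'']; exact mem_hmBBeBox S hS v cv hB₃ K r' r''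
  sm := mem_smidEBox S hS v cv hB₃ K J

/-- Box of `psiMidE` from a moment record and the full record of the block mode `i'` (`θ = θn/θd`).
[cite: Moore1966, Ch. 3 (interval arithmetic: inclusion property)] -/
def psiMidEBox (S : ℕ) (C : Consts) (F : FDConsts) (R : IdxRec) (θn θd J : ℕ) (M : MidMom) (i' r : ℕ) : MI :=
  if r < J then
    (((sumBox S (fun j' ↦ (getMI M.AA r j').mul S (vAeBox S i' j')) J).add
      (sumBox S (fun r' ↦ (getMI M.AB r r').mul S (vBeBox S C F R i' r')) J)).mulInt ((θd + θn : ℕ) : ℤ)).divNat θd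
  else
    (((sumBox S (fun j ↦ (getMI M.BA (r - J) j).mul S (vAeBox S i' j)) J).add
      (sumBox S (fun r'' ↦ (getMI M.BB (r - J) r'').mul S (vBeBox S C F R i' r'')) J)).mulInt ((θd + θn : ℕ) : ℤ)).divNat θd

/-- [cite: Moore1966, Ch. 3 (interval arithmetic: inclusion property)] -/
theorem mem_psiMidEBox (hS : 0 < S) (hks : PrimeData a ks) (hC : ConstsValid S a ks C) {F : FDConsts}
    (hF : FDValid S a F) {w : ℕ → ℝ} {B₃ B₄ J : ℕ} {M : MidMom} (hM : MidMomValidE S a w B₃ B₄ J M)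
    {θn θd : ℕ} (hθd : 0 < θd) {i' : ℕ} {R : IdxRec} (hR : OffValid S a ks (i' : ℤ) R) {r : ℕ} (hr2 : r < J + J) :
    MI.mem S (psiMidE a ((θn : ℝ) / θd) B₃ B₄ J w i' r) (psiMidEBox S C F R θn θd J M i' r) := by
  unfold psiMidE psiMidEBox
  have hθd' : (θd : ℝ) ≠ 0 := by exact_mod_cast hθd.ne'
  split_ifs with hr
  · have hs := MI.mem_add
      (mem_sumBox S J (fun j' hj' ↦ MI.mem_mul hS (hM.AA r hr j' hj') (mem_vAeBox S i' j')))
      (mem_sumBox S J (fun r' hr' ↦ MI.mem_mul hS (hM.AB r hr r' hr') (mem_vBeBox hS hks hC hF hR (r := r'))))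
    have h := MI.mem_divNat (MI.mem_mulInt hs ((θd + θn : ℕ) : ℤ)) hθd
    refine mem_of_eq h ?_
    push_cast; field_simp
  · have hrJ : r - J < J := by omega
    have hs := MI.mem_add
      (mem_sumBox S J (fun j hj ↦ MI.mem_mul hS (hM.BA (r - J) hrJ j hj) (mem_vAeBox S i' j)))
      (mem_sumBox S J (fun r'' hr'' ↦ MI.mem_mul hS (hM.BB (r - J) hrJ r'' hr'') (mem_vBeBox hS hks hC hF hR (r := r''))))
    have h := MI.mem_divNat (MI.mem_mulInt hs ((θd + θn : ℕ) : ℤ)) hθd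
    refine mem_of_eq h ?_
    push_cast; field_simp


/-- `ψ·B^{p(r)}` box (even middle). [cite: Moore1966, Ch. 3 (interval arithmetic: inclusion property)] -/
def psiMidESBox (S : ℕ) (C : Consts) (F : FDConsts) (R : IdxRec) (θn θd B J : ℕ) (M : MidMom) (i' r : ℕ) : MI :=
  (psiMidEBox S C F R θn θd J M i' r).mulInt ((B : ℤ) ^ pJe J r)

/-- [cite: Moore1966, Ch. 3 (interval arithmetic: inclusion property)] -/
theorem mem_psiMidESBox (hS : 0 < S) (hks : PrimeData a ks) (hC : ConstsValid S a ks C) {F : FDConsts}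
    (hF : FDValid S a F) {w : ℕ → ℝ} {B₃ B₄ J : ℕ} {M : MidMom} (hM : MidMomValidE S a w B₃ B₄ J M)
    {θn θd : ℕ} (hθd : 0 < θd) (B : ℕ) {i' : ℕ} {R : IdxRec} (hR : OffValid S a ks (i' : ℤ) R) {r : ℕ} (hr2 : r < J + J) :
    MI.mem S (psiMidES a ((θn : ℝ) / θd) B B₃ B₄ J w i' r) (psiMidESBox S C F R θn θd B J M i' r) := by
  unfold psiMidES psiMidESBox
  have h := MI.mem_mulInt (mem_psiMidEBox hS hks hC hF hM hθd hR hr2 (θn := θn)) ((B : ℤ) ^ pJe J r)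
  refine mem_of_eq h ?_
  push_cast; rfl

/-- Box of `dMidE` (`θ = θn/θd`). [cite: Moore1966, Ch. 3 (interval arithmetic: inclusion property)] -/
def dMidEBox (S : ℕ) (C : Consts) (F : FDConsts) (R : IdxRec) (θn θd B J : ℕ) (M : MidMom) (i : ℕ) : MI :=
  ((((rhoEBox S C F R J i).sqr S).mul S M.sm).mulInt (((θn + θd) * B : ℕ) : ℤ)).divNat θn

/-- [cite: Moore1966, Ch. 3 (interval arithmetic: inclusion property)] -/
theorem mem_dMidEBox (hS : 0 < S) (hC : ConstsValid S a ks C) {F : FDConsts} (hF : FDValid S a F)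
    {w : ℕ → ℝ} {B₃ B₄ J : ℕ} {M : MidMom} (hM : MidMomValidE S a w B₃ B₄ J M) {θn θd : ℕ} (hθn : 0 < θn)
    (hθd : 0 < θd) (B : ℕ) {i : ℕ} {R : IdxRec} (hR : OffValid S a ks (i : ℤ) R) :
    MI.mem S (dMidE a ((θn : ℝ) / θd) B B₃ B₄ J w i) (dMidEBox S C F R θn θd B J M i) := by
  unfold dMidE dMidEBox
  have hθn' : (θn : ℝ) ≠ 0 := by exact_mod_cast hθn.ne'
  have hθd' : (θd : ℝ) ≠ 0 := by exact_mod_cast hθd.ne'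
  have h := MI.mem_divNat (MI.mem_mulInt (MI.mem_mul hS (MI.mem_sqr hS (mem_rhoEBox hS hC hF (Je := J) hR)) hM.sm)
    (((θn + θd) * B : ℕ) : ℤ)) hθn
  refine mem_of_eq h ?_
  push_cast; field_simp

/-! ## Odd sector: block boxes, the moment record, factor boxes -/

/-- Box of `hmAAo` over the light table. [cite: Moore1966, Ch. 3 (interval arithmetic: inclusion property)] -/
def hmAAoBox (S : ℕ) (C : Consts) (ctab : List IdxRec) (cv : ℕ) (v : List ℕ) (B₃ K j j' : ℕ) : MI :=
  sumBox S (fun t ↦ (((fAoBox S C (tget ctab (B₃ + t + 1)) (B₃ + t) j).mul S (fAoBox S C (tget ctab (B₃ + t + 1)) (B₃ + t) j')).mulInt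
    (v.getD t 0 : ℤ)).divNat (2 ^ cv)) K

/-- Box of `hmABo`. [cite: Moore1966, Ch. 3 (interval arithmetic: inclusion property)] -/
def hmABoBox (S : ℕ) (C : Consts) (ctab : List IdxRec) (cv : ℕ) (v : List ℕ) (B₃ K j r' : ℕ) : MI :=
  sumBox S (fun t ↦ (((fAoBox S C (tget ctab (B₃ + t + 1)) (B₃ + t) j).mul S (MI.ofFrac S 1 ((B₃ + t + 1) ^ (2 * r' + 1)))).mulInt
    (v.getD t 0 : ℤ)).divNat (2 ^ cv)) K

/-- Box of `hmBAo`. [cite: Moore1966, Ch. 3 (interval arithmetic: inclusion property)] -/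
def hmBAoBox (S : ℕ) (C : Consts) (ctab : List IdxRec) (cv : ℕ) (v : List ℕ) (B₃ K r' j : ℕ) : MI :=
  sumBox S (fun t ↦ (((MI.ofFrac S 1 ((B₃ + t + 1) ^ (2 * r' + 1))).mul S (fAoBox S C (tget ctab (B₃ + t + 1)) (B₃ + t) j)).mulInt
    (v.getD t 0 : ℤ)).divNat (2 ^ cv)) K

/-- Box of `hmBBo` (exact rationals). [cite: Moore1966, Ch. 3 (interval arithmetic: inclusion property)] -/
def hmBBoBox (S : ℕ) (cv : ℕ) (v : List ℕ) (B₃ K r' r'' : ℕ) : MI :=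
  sumBox S (fun t ↦ (((MI.ofFrac S 1 ((B₃ + t + 1) ^ (2 * r' + 1))).mul S (MI.ofFrac S 1 ((B₃ + t + 1) ^ (2 * r'' + 1)))).mulInt
    (v.getD t 0 : ℤ)).divNat (2 ^ cv)) K

/-- Box of `smidO`. [cite: Moore1966, Ch. 3 (interval arithmetic: inclusion property)] -/
def smidOBox (S : ℕ) (cv : ℕ) (v : List ℕ) (B₃ K J : ℕ) : MI :=
  sumBox S (fun t ↦ (((MI.ofFrac S 1 ((B₃ + t + 1) ^ (2 * J + 1))).sqr S).mulInt (v.getD t 0 : ℤ)).divNat (2 ^ cv)) K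


/-- Record validity at the odd column `l = B₃ + t` (mode `l + 1`) from the light table.
[cite: Moore1966, Ch. 3 (interval arithmetic: inclusion property)] -/
theorem offValid_odd_col {ctab : List IdxRec} {B₃ K : ℕ} (hCT : TabColValid S a ks (B₃ + 1) (B₃ + K + 1) ctab)
    {t : ℕ} (ht : t < K) : OffValid S a ks (((B₃ + t : ℕ) : ℤ) + 1) (tget ctab (B₃ + t + 1)) := by
  have h := (hCT (B₃ + t + 1) (by omega) (by omega)).1
  have e : (((B₃ + t + 1 : ℕ) : ℤ)) = ((B₃ + t : ℕ) : ℤ) + 1 := by push_cast; ring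
  rwa [e] at h

variable {ctab : List IdxRec} {cv B₃ K : ℕ} {v : List ℕ}

/-- [cite: Moore1966, Ch. 3 (interval arithmetic: inclusion property)] -/
theorem mem_hmAAoBox (hS : 0 < S) (hks : PrimeData a ks) (hC : ConstsValid S a ks C)
    (hCT : TabColValid S a ks (B₃ + 1) (B₃ + K + 1) ctab) (j j' : ℕ) :
    MI.mem S (hmAAo a (wvF v cv B₃) B₃ (B₃ + K) j j') (hmAAoBox S C ctab cv v B₃ K j j') := by
  unfold hmAAo hmAAoBox
  refine mem_sumBox_div_wvF S v cv B₃ K fun t ht ↦ ?_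
  have hR := offValid_odd_col hCT ht
  exact MI.mem_mul hS (mem_fAoBox hS hks hC (B₃ + t) j hR) (mem_fAoBox hS hks hC (B₃ + t) j' hR)

/-- [cite: Moore1966, Ch. 3 (interval arithmetic: inclusion property)] -/
theorem mem_hmABoBox (hS : 0 < S) (hks : PrimeData a ks) (hC : ConstsValid S a ks C)
    (hCT : TabColValid S a ks (B₃ + 1) (B₃ + K + 1) ctab) (j r' : ℕ) :
    MI.mem S (hmABo a (wvF v cv B₃) B₃ (B₃ + K) j r') (hmABoBox S C ctab cv v B₃ K j r') := by
  unfold hmABo hmABoBox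
  refine mem_sumBox_div_wvF S v cv B₃ K fun t ht ↦ ?_
  have hR := offValid_odd_col hCT ht
  have hm : 0 < B₃ + t + 1 := by omega
  have h := MI.mem_mul hS (mem_fAoBox hS hks hC (B₃ + t) j hR)
    (MI.mem_ofFrac S 1 (q := (B₃ + t + 1) ^ (2 * r' + 1)) (Nat.pow_pos hm))
  refine mem_of_eq h ?_
  push_cast; ring

/-- [cite: Moore1966, Ch. 3 (interval arithmetic: inclusion property)] -/
theorem mem_hmBAoBox (hS : 0 < S) (hks : PrimeData a ks) (hC : ConstsValid S a ks C)
    (hCT : TabColValid S a ks (B₃ + 1) (B₃ + K + 1) ctab) (r' j : ℕ) :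
    MI.mem S (hmBAo a (wvF v cv B₃) B₃ (B₃ + K) r' j) (hmBAoBox S C ctab cv v B₃ K r' j) := by
  unfold hmBAo hmBAoBox
  refine mem_sumBox_div_wvF S v cv B₃ K fun t ht ↦ ?_
  have hR := offValid_odd_col hCT ht
  have hm : 0 < B₃ + t + 1 := by omega
  have h := MI.mem_mul hS (MI.mem_ofFrac S 1 (q := (B₃ + t + 1) ^ (2 * r' + 1)) (Nat.pow_pos hm))
    (mem_fAoBox hS hks hC (B₃ + t) j hR)
  refine mem_of_eq h ?_
  push_cast; ring

/-- [cite: Moore1966, Ch. 3 (interval arithmetic: inclusion property)] -/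
theorem mem_hmBBoBox (S : ℕ) (hS : 0 < S) (v : List ℕ) (cv B₃ K r' r'' : ℕ) :
    MI.mem S (hmBBo (wvF v cv B₃) B₃ (B₃ + K) r' r'') (hmBBoBox S cv v B₃ K r' r'') := by
  unfold hmBBo hmBBoBox
  refine mem_sumBox_div_wvF S v cv B₃ K fun t _ ↦ ?_
  have hm : 0 < B₃ + t + 1 := by omega
  have h := MI.mem_mul hS (MI.mem_ofFrac S 1 (q := (B₃ + t + 1) ^ (2 * r' + 1)) (Nat.pow_pos hm))
    (MI.mem_ofFrac S 1 (q := (B₃ + t + 1) ^ (2 * r'' + 1)) (Nat.pow_pos hm))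
  refine mem_of_eq h ?_
  push_cast; ring

/-- [cite: Moore1966, Ch. 3 (interval arithmetic: inclusion property)] -/
theorem mem_smidOBox (S : ℕ) (hS : 0 < S) (v : List ℕ) (cv B₃ K J : ℕ) :
    MI.mem S (smidO (wvF v cv B₃) B₃ (B₃ + K) J) (smidOBox S cv v B₃ K J) := by
  unfold smidO smidOBox
  refine mem_sumBox_div_wvF S v cv B₃ K fun t _ ↦ ?_
  have hm : 0 < B₃ + t + 1 := by omega
  have h := MI.mem_sqr hS (MI.mem_ofFrac S 1 (q := (B₃ + t + 1) ^ (2 * J + 1)) (Nat.pow_pos hm))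
  refine mem_of_eq h ?_
  push_cast; ring

/-- The odd moment record computed from the light table. [cite: Yoshida1992HermitianForms, §7 pp. 305–312] -/
def midMomO (S : ℕ) (C : Consts) (ctab : List IdxRec) (cv : ℕ) (v : List ℕ) (B₃ K J : ℕ) : MidMom :=
  ⟨tabJ J (hmAAoBox S C ctab cv v B₃ K), tabJ J (hmABoBox S C ctab cv v B₃ K), tabJ J (hmBAoBox S C ctab cv v B₃ K),
    tabJ J (hmBBoBox S cv v B₃ K), smidOBox S cv v B₃ K J⟩

/-- Validity of an odd moment record for the weights `w` on `[B₃, B₄)`. [cite: Moore1966, Ch. 3 (interval arithmetic: inclusion property)] -/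
structure MidMomValidO (S : ℕ) (a : ℝ) (w : ℕ → ℝ) (B₃ B₄ J : ℕ) (M : MidMom) : Prop where
  /-- block `AA` -/
  AA : ∀ j < J, ∀ j' < J, MI.mem S (hmAAo a w B₃ B₄ j j') (getMI M.AA j j')
  /-- block `AB` -/
  AB : ∀ j < J, ∀ r' < J, MI.mem S (hmABo a w B₃ B₄ j r') (getMI M.AB j r')
  /-- block `BA` -/
  BA : ∀ r' < J, ∀ j < J, MI.mem S (hmBAo a w B₃ B₄ r' j) (getMI M.BA r' j)
  /-- block `BB` -/
  BB : ∀ r' < J, ∀ r'' < J, MI.mem S (hmBBo w B₃ B₄ r' r'') (getMI M.BB r' r'')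
  /-- moment -/
  sm : MI.mem S (smidO w B₃ B₄ J) M.sm

/-- **The computed odd moment record is valid** (light table valid on the middle range).
[cite: Moore1966, Ch. 3 (interval arithmetic: inclusion property)] -/
theorem midMomO_valid (hS : 0 < S) (hks : PrimeData a ks) (hC : ConstsValid S a ks C)
    (hCT : TabColValid S a ks (B₃ + 1) (B₃ + K + 1) ctab) (J : ℕ) :
    MidMomValidO S a (wvF v cv B₃) B₃ (B₃ + K) J (midMomO S C ctab cv v B₃ K J) where
  AA j hj j' hj' := by rw [midMomO, getMI_tabJ _ hj hj']; exact mem_hmAAoBox hS hks hC hCT j j'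
  AB j hj r' hr' := by rw [midMomO, getMI_tabJ _ hj hr']; exact mem_hmABoBox hS hks hC hCT j r'
  BA r' hr' j hj := by rw [midMomO, getMI_tabJ _ hr' hj]; exact mem_hmBAoBox hS hks hC hCT r' j
  BB r' hr' r'' hr'' := by rw [midMomO, getMI_tabJ _ hr' hr'']; exact mem_hmBBoBox S hS v cv B₃ K r' r''
  sm := mem_smidOBox S hS v cv B₃ K J

/-- Box of `psiMidO` from a moment record and the full record of the block mode `i'` (`θ = θn/θd`).
[cite: Moore1966, Ch. 3 (interval arithmetic: inclusion property)] -/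
def psiMidOBox (S : ℕ) (C : Consts) (F : FDConsts) (R : IdxRec) (θn θd J : ℕ) (M : MidMom) (i' r : ℕ) : MI :=
  if r < J then
    (((sumBox S (fun j' ↦ (getMI M.AA r j').mul S (vAoBox S i' j')) J).add
      (sumBox S (fun r' ↦ (getMI M.AB r r').mul S (vBoBox S C F R i' r')) J)).mulInt ((θd + θn : ℕ) : ℤ)).divNat θd
  else
    (((sumBox S (fun j ↦ (getMI M.BA (r - J) j).mul S (vAoBox S i' j)) J).add
      (sumBox S (fun r'' ↦ (getMI M.BB (r - J) r'').mul S (vBoBox S C F R i' r'')) J)).mulInt ((θd + θn : ℕ) : ℤ)).divNat θd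

/-- [cite: Moore1966, Ch. 3 (interval arithmetic: inclusion property)] -/
theorem mem_psiMidOBox (hS : 0 < S) (hks : PrimeData a ks) (hC : ConstsValid S a ks C) {F : FDConsts}
    (hF : FDValid S a F) {w : ℕ → ℝ} {B₃ B₄ J : ℕ} {M : MidMom} (hM : MidMomValidO S a w B₃ B₄ J M)
    {θn θd : ℕ} (hθd : 0 < θd) {i' : ℕ} {R : IdxRec} (hR : OffValid S a ks ((i' : ℤ) + 1) R) {r : ℕ} (hr2 : r < J + J) :
    MI.mem S (psiMidO a ((θn : ℝ) / θd) B₃ B₄ J w i' r) (psiMidOBox S C F R θn θd J M i' r) := by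
  unfold psiMidO psiMidOBox
  have hθd' : (θd : ℝ) ≠ 0 := by exact_mod_cast hθd.ne'
  split_ifs with hr
  · have hs := MI.mem_add
      (mem_sumBox S J (fun j' hj' ↦ MI.mem_mul hS (hM.AA r hr j' hj') (mem_vAoBox S i' j')))
      (mem_sumBox S J (fun r' hr' ↦ MI.mem_mul hS (hM.AB r hr r' hr') (mem_vBoBox hS hks hC hF hR (r := r'))))
    have h := MI.mem_divNat (MI.mem_mulInt hs ((θd + θn : ℕ) : ℤ)) hθd
    refine mem_of_eq h ?_
    push_cast; field_simp
  · have hrJ : r - J < J := by omega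
    have hs := MI.mem_add
      (mem_sumBox S J (fun j hj ↦ MI.mem_mul hS (hM.BA (r - J) hrJ j hj) (mem_vAoBox S i' j)))
      (mem_sumBox S J (fun r'' hr'' ↦ MI.mem_mul hS (hM.BB (r - J) hrJ r'' hr'') (mem_vBoBox hS hks hC hF hR (r := r''))))
    have h := MI.mem_divNat (MI.mem_mulInt hs ((θd + θn : ℕ) : ℤ)) hθd
    refine mem_of_eq h ?_
    push_cast; field_simp


/-- `ψ·B^{p(r)}` box (odd middle). [cite: Moore1966, Ch. 3 (interval arithmetic: inclusion property)] -/
def psiMidOSBox (S : ℕ) (C : Consts) (F : FDConsts) (R : IdxRec) (θn θd B J : ℕ) (M : MidMom) (i' r : ℕ) : MI :=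
  (psiMidOBox S C F R θn θd J M i' r).mulInt ((B : ℤ) ^ pJo J r)

/-- [cite: Moore1966, Ch. 3 (interval arithmetic: inclusion property)] -/
theorem mem_psiMidOSBox (hS : 0 < S) (hks : PrimeData a ks) (hC : ConstsValid S a ks C) {F : FDConsts}
    (hF : FDValid S a F) {w : ℕ → ℝ} {B₃ B₄ J : ℕ} {M : MidMom} (hM : MidMomValidO S a w B₃ B₄ J M)
    {θn θd : ℕ} (hθd : 0 < θd) (B : ℕ) {i' : ℕ} {R : IdxRec} (hR : OffValid S a ks ((i' : ℤ) + 1) R) {r : ℕ} (hr2 : r < J + J) :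
    MI.mem S (psiMidOS a ((θn : ℝ) / θd) B B₃ B₄ J w i' r) (psiMidOSBox S C F R θn θd B J M i' r) := by
  unfold psiMidOS psiMidOSBox
  have h := MI.mem_mulInt (mem_psiMidOBox hS hks hC hF hM hθd hR hr2 (θn := θn)) ((B : ℤ) ^ pJo J r)
  refine mem_of_eq h ?_
  push_cast; rfl

/-- Box of `dMidO` (`θ = θn/θd`). [cite: Moore1966, Ch. 3 (interval arithmetic: inclusion property)] -/
def dMidOBox (S : ℕ) (C : Consts) (F : FDConsts) (R : IdxRec) (θn θd B J : ℕ) (M : MidMom) (i : ℕ) : MI :=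
  ((((rhoOBox S C F R J i).sqr S).mul S M.sm).mulInt (((θn + θd) * B : ℕ) : ℤ)).divNat θn

/-- [cite: Moore1966, Ch. 3 (interval arithmetic: inclusion property)] -/
theorem mem_dMidOBox (hS : 0 < S) (hC : ConstsValid S a ks C) {F : FDConsts} (hF : FDValid S a F)
    {w : ℕ → ℝ} {B₃ B₄ J : ℕ} {M : MidMom} (hM : MidMomValidO S a w B₃ B₄ J M) {θn θd : ℕ} (hθn : 0 < θn)
    (hθd : 0 < θd) (B : ℕ) {i : ℕ} {R : IdxRec} (hR : OffValid S a ks ((i : ℤ) + 1) R) :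
    MI.mem S (dMidO a ((θn : ℝ) / θd) B B₃ B₄ J w i) (dMidOBox S C F R θn θd B J M i) := by
  unfold dMidO dMidOBox
  have hθn' : (θn : ℝ) ≠ 0 := by exact_mod_cast hθn.ne'
  have hθd' : (θd : ℝ) ≠ 0 := by exact_mod_cast hθd.ne'
  have h := MI.mem_divNat (MI.mem_mulInt (MI.mem_mul hS (MI.mem_sqr hS (mem_rhoOBox hS hC hF (Jo := J) hR)) hM.sm)
    (((θn + θd) * B : ℕ) : ℤ)) hθn
  refine mem_of_eq h ?_
  push_cast; field_simp


end Encl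

end Literature.NumberTheory.LFunctions.Yoshida1992
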